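import Summits.AnomalousDissipation.AnomalousDissipation.Theorems.BaireTransferRobustLoudUpgradeLine
import Literature.Analysis.FunctionSpaces.TorusInverseLaplacianCalculus

/-!
# Stub `stub_realKernel` of the line `malkin-cone-group-orbits` (crux stmt-AnomalousDissipation-1144, lead c14):
# a complex classical kernel vector of the linearised steady Navier–Stokes operator of a REAL state yields a
# non-zero REAL one

Registered signature (proved here, textually):
`theorem stub_realKernel : ∀ (ν : ℝ) (U : UnitAddTorus (Fin 3) → EuclideanSpace ℝ (Fin 3)), IsSmooth U →
  Torus.IsLinNSEigenvalue ν U 0 → ∃ v, v ≠ 0 ∧ Torus.LinNSResolventRel ν U 0 (cplx v) 0`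
(vocabulary: `Literature/Analysis/FluidPDE/LinearizedNSTorus.lean`; `cplx v = realToComplex ∘ v` of the line's
vocabulary module `…Theorems/BaireTransferRobustLoudUpgradeLine.lean`).

Proof (reality of the linearisation).  The classical homogeneous relation `L(ν,U)(w,q) = 0`,
`L(ν,U)(w,q) = νΔw − (U·∇)w − (w·∇)U − ∇q`, `div w = 0`, `∫ w = 0`, is built from REAL derivatives
(`Torus.laplacian`, `Torus.fderiv`, `Torus.partialDeriv`) of the complex field `w : T³ → ℂ³` and involves the
real state `U` only through the REAL vectors `U(x)` and `∂ⱼU(x)`.  Hence it is transported along any continuous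
real-linear map `φ : ℂ → ℂ` acting coordinatewise (`P : ℂ³ → ℂ³`, `(P z)ᵢ = φ(zᵢ)`): derivatives commute with
post-composition by a continuous linear map (`laplacian_clm_comp_apply`, `partialDeriv_clm_comp`,
`convect_eq_sum_smul_partialDeriv`), and `φ(c a) = φ(c) a` for real `a` handles the stretching term
`∑ⱼ wⱼ ∂ⱼU` (§1, `linNSResolventRel_clm_comp`).  With `φ = Re` and `φ = Im` (as maps into `ℂ`) the real
fields `Re w`, `Im w` have `cplx (Re w) = P_Re ∘ w`, `cplx (Im w) = P_Im ∘ w`, so both are classical kernel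
fields, and they are not both zero since `w = Re w + i Im w ≠ 0` (§2).  Pure proof file (no definitions).

References: P. Constantin, C. Foias, *Navier–Stokes Equations* (1988), Ch. 7 (the linearisation is a real
operator); B. Fiedler, LNM 1309 (1988), §2 (complexified point spectrum).
-/

-- `Summit.<Summit>.<Problem>` is the tree's mandated summit-side namespace (CONVENTIONS §2); for this
-- single-conjunct summit the two coincide, so the duplicate is deliberate.
set_option linter.dupNamespace false

noncomputable section

open scoped BigOperators Topology
open Filter Set Function TopologicalSpace MeasureTheory

namespace Summit.AnomalousDissipation.AnomalousDissipation.Theorems.RobustLoudUpgrade.Poly.RealKernel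

open Literature.Analysis.FunctionSpaces Literature.Analysis.FunctionSpaces.Torus
open Literature.Analysis.FunctionSpaces.EuclideanSpace
open Literature.Analysis.FluidPDE
open Summit.AnomalousDissipation.AnomalousDissipation.Theses.BaireTransfer
open Summit.AnomalousDissipation.AnomalousDissipation.Theorems.RobustLoudUpgrade

/-! ## §1 Coordinatewise real-linear maps commute with the linearised operator -/

section Transfer

variable {ν : ℝ} {U : UnitAddTorus (Fin 3) → EuclideanSpace ℝ (Fin 3)}
  {w : UnitAddTorus (Fin 3) → EuclideanSpace ℂ (Fin 3)} {q : UnitAddTorus (Fin 3) → ℂ}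
  {P : EuclideanSpace ℂ (Fin 3) →L[ℝ] EuclideanSpace ℂ (Fin 3)} {φ : ℂ →L[ℝ] ℂ}

/-- A real-linear `φ : ℂ → ℂ` is `ℝ`-homogeneous on the right: `φ (c a) = φ(c) a` for real `a`. [folklore] -/
theorem clm_mul_ofReal (φ : ℂ →L[ℝ] ℂ) (c : ℂ) (a : ℝ) : φ (c * (a : ℂ)) = φ c * (a : ℂ) := by
  have h := φ.map_smul a c
  rw [Complex.real_smul, Complex.real_smul] at h
  rw [mul_comm c, h, mul_comm]

/-- `P (c • a) = φ(c) • a` for a complexified real vector `a`, when `P` acts coordinatewise by `φ`. [folklore] -/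
theorem clm_smul_realToComplex (hP : ∀ (z : EuclideanSpace ℂ (Fin 3)) (i : Fin 3), P z i = φ (z i)) (c : ℂ)
    (a : EuclideanSpace ℝ (Fin 3)) :
    P (c • Torus.realToComplex a) = φ c • Torus.realToComplex a := by
  ext i
  rw [hP, PiLp.smul_apply, PiLp.smul_apply, Torus.realToComplex_apply, smul_eq_mul, smul_eq_mul,
    clm_mul_ofReal]

/-- Coordinates of a smooth complex field are smooth. [folklore] -/
theorem isSmooth_apply_complex (hw : IsSmooth w) (i : Fin 3) : IsSmooth fun y => w y i := by
  have h := hw.comp_clm ((EuclideanSpace.proj i : EuclideanSpace ℂ (Fin 3) →L[ℂ] ℂ).restrictScalars ℝ)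
  have e : (⇑((EuclideanSpace.proj i : EuclideanSpace ℂ (Fin 3) →L[ℂ] ℂ).restrictScalars ℝ) ∘ w) =
      fun y => w y i := by
    funext y; simp
  rwa [e] at h

/-- `div (P ∘ w) = φ (div w)` for smooth `w`, when `P` acts coordinatewise by `φ`. [folklore] -/
theorem divergenceC_clm_comp (hP : ∀ (z : EuclideanSpace ℂ (Fin 3)) (i : Fin 3), P z i = φ (z i))
    (hw : IsSmooth w) (x : UnitAddTorus (Fin 3)) :
    Torus.divergenceC (P ∘ w) x = φ (Torus.divergenceC w x) := by
  simp only [Torus.divergenceC, map_sum]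
  refine Finset.sum_congr rfl fun i _ => ?_
  have e : (fun y => (⇑P ∘ w) y i) = (⇑φ ∘ fun y => w y i) := by
    funext y; simp [hP]
  rw [e, partialDeriv_clm_comp (isSmooth_apply_complex hw i) φ i x]

/-- `(U·∇)(P ∘ w) = P ((U·∇)w)` for smooth `w`. [folklore] -/
theorem convect_clm_comp (hw : IsSmooth w) (P : EuclideanSpace ℂ (Fin 3) →L[ℝ] EuclideanSpace ℂ (Fin 3))
    (x : UnitAddTorus (Fin 3)) :
    convect U (P ∘ w) x = P (convect U w x) := by
  rw [convect_eq_sum_smul_partialDeriv ((hw.comp_clm P).isContDiff (by simp)) x,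
    convect_eq_sum_smul_partialDeriv (hw.isContDiff (by simp)) x, map_sum]
  refine Finset.sum_congr rfl fun i _ => ?_
  rw [map_smul, partialDeriv_clm_comp hw P i x]

/-- `((P ∘ w)·∇)U = P ((w·∇)U)`: the real vectors `∂ⱼU(x)` pass through `φ`. [folklore] -/
theorem stretch_clm_comp (hP : ∀ (z : EuclideanSpace ℂ (Fin 3)) (i : Fin 3), P z i = φ (z i))
    (U : UnitAddTorus (Fin 3) → EuclideanSpace ℝ (Fin 3)) (x : UnitAddTorus (Fin 3)) :
    Torus.stretch (P ∘ w) U x = P (Torus.stretch w U x) := by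
  simp only [Torus.stretch, Function.comp_apply, hP, map_sum, clm_smul_realToComplex hP]

/-- `∇(φ ∘ q) = P (∇q)` for smooth `q`, when `P` acts coordinatewise by `φ`. [folklore] -/
theorem gradientC_clm_comp (hP : ∀ (z : EuclideanSpace ℂ (Fin 3)) (i : Fin 3), P z i = φ (z i))
    (hq : IsSmooth q) (x : UnitAddTorus (Fin 3)) :
    Torus.gradientC (φ ∘ q) x = P (Torus.gradientC q x) := by
  ext i
  rw [hP]
  simp only [Torus.gradientC, PiLp.toLp_apply]
  exact partialDeriv_clm_comp hq φ i x

/-- `∫ P ∘ w = 0` if `∫ w = 0`, for smooth `w`. [folklore] -/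
theorem hasZeroMean_clm_comp (hw : IsSmooth w) (h0 : HasZeroMean w)
    (P : EuclideanSpace ℂ (Fin 3) →L[ℝ] EuclideanSpace ℂ (Fin 3)) : HasZeroMean (P ∘ w) := by
  unfold HasZeroMean at h0 ⊢
  simp only [Function.comp_apply]
  rw [ContinuousLinearMap.integral_comp_comm P hw.integrable, h0, map_zero]

/-- `L(ν,U)(P ∘ w, φ ∘ q) = P (L(ν,U)(w, q))` for smooth `w`, `q`, when `P` acts coordinatewise by `φ`. [folklore] -/
theorem linearizedNSOperator_clm_comp (hP : ∀ (z : EuclideanSpace ℂ (Fin 3)) (i : Fin 3), P z i = φ (z i))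
    (hw : IsSmooth w) (hq : IsSmooth q) (x : UnitAddTorus (Fin 3)) :
    Torus.linearizedNSOperator ν U (P ∘ w) (φ ∘ q) x = P (Torus.linearizedNSOperator ν U w q x) := by
  rw [Torus.linearizedNSOperator_apply, Torus.linearizedNSOperator_apply, laplacian_clm_comp_apply hw P x,
    convect_clm_comp hw P x, stretch_clm_comp hP U x, gradientC_clm_comp hP hq x]
  simp only [map_sub, map_add, map_smul]

/-- **Transfer of the homogeneous linearised relation along a coordinatewise real-linear map**: if `(w, q)` is a
classical kernel pair of `L(ν,U)` in the mean-zero divergence-free class, so is `(P ∘ w, φ ∘ q)`. [folklore] -/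
theorem linNSResolventRel_clm_comp (hP : ∀ (z : EuclideanSpace ℂ (Fin 3)) (i : Fin 3), P z i = φ (z i))
    (hw : Torus.LinNSResolventRel ν U 0 w 0) : Torus.LinNSResolventRel ν U 0 (P ∘ w) 0 := by
  obtain ⟨hws, hwd, hwm, q, hqs, hEq⟩ := hw
  refine ⟨hws.comp_clm P, fun x => ?_, hasZeroMean_clm_comp hws hwm P, φ ∘ q, hqs.comp_clm φ, fun x => ?_⟩
  · rw [divergenceC_clm_comp hP hws x, hwd x, map_zero]
  · have h := hEq x
    simp only [zero_smul, sub_zero, Pi.zero_apply] at h ⊢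
    rw [linearizedNSOperator_clm_comp hP hws hqs x, h, map_zero]

end Transfer

/-! ## §2 Real and imaginary parts of a complex kernel vector -/

section Parts

variable {ν : ℝ} {U : UnitAddTorus (Fin 3) → EuclideanSpace ℝ (Fin 3)}
  {w : UnitAddTorus (Fin 3) → EuclideanSpace ℂ (Fin 3)}

/-- The real part `Re w` of a classical kernel field is a (real) classical kernel field. [folklore] -/
theorem linNSResolventRel_realPart (hw : Torus.LinNSResolventRel ν U 0 w 0) :
    Torus.LinNSResolventRel ν U 0 (cplx fun x => EuclideanSpace.realPart (w x)) 0 := by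
  have hP : ∀ (z : EuclideanSpace ℂ (Fin 3)) (i : Fin 3),
      (complexify.toContinuousLinearMap.comp EuclideanSpace.realPart) z i =
        (Complex.ofRealCLM.comp Complex.reCLM) (z i) := by
    intro z i; simp
  have e : cplx (fun x => EuclideanSpace.realPart (w x)) =
      (⇑(complexify.toContinuousLinearMap.comp EuclideanSpace.realPart) ∘ w) := by
    funext x; ext i; simp [cplx]
  rw [e]
  exact linNSResolventRel_clm_comp hP hw

/-- The imaginary part `Im w = Re (−i w)` of a classical kernel field is a (real) classical kernel field.
[folklore] -/
theorem linNSResolventRel_imagPart (hw : Torus.LinNSResolventRel ν U 0 w 0) :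
    Torus.LinNSResolventRel ν U 0 (cplx fun x => EuclideanSpace.realPart ((-Complex.I) • w x)) 0 := by
  have hP : ∀ (z : EuclideanSpace ℂ (Fin 3)) (i : Fin 3),
      ((complexify.toContinuousLinearMap.comp EuclideanSpace.realPart).comp
          (((-Complex.I) • ContinuousLinearMap.id ℂ (EuclideanSpace ℂ (Fin 3))).restrictScalars ℝ)) z i =
        (Complex.ofRealCLM.comp Complex.imCLM) (z i) := by
    intro z i; simp
  have e : cplx (fun x => EuclideanSpace.realPart ((-Complex.I) • w x)) =
      (⇑((complexify.toContinuousLinearMap.comp EuclideanSpace.realPart).comp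
          (((-Complex.I) • ContinuousLinearMap.id ℂ (EuclideanSpace ℂ (Fin 3))).restrictScalars ℝ)) ∘ w) := by
    funext x; ext i; simp [cplx]
  rw [e]
  exact linNSResolventRel_clm_comp hP hw

end Parts

/-! ## §3 The registered stub -/

/-- **The registered stub `stub_realKernel`** (reality of the linearisation): the linearised steady operator
`L(ν,U)` of a REAL state `U` commutes with complex conjugation, so a classical kernel vector in the mean-zero class
(`Torus.IsLinNSEigenvalue ν U 0`, complex `w ≠ 0`) yields a non-zero REAL classical kernel field `v` (`Re w` or
`Im w`), in the line's vocabulary `cplx v = realToComplex ∘ v`. [folklore] -/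
theorem stub_realKernel :
    ∀ (ν : ℝ) (U : UnitAddTorus (Fin 3) → EuclideanSpace ℝ (Fin 3)), IsSmooth U → Torus.IsLinNSEigenvalue ν U 0 →
      ∃ v : UnitAddTorus (Fin 3) → EuclideanSpace ℝ (Fin 3), v ≠ 0 ∧ Torus.LinNSResolventRel ν U 0 (cplx v) 0 := by
  intro ν U _ hev
  obtain ⟨w, hw0, hw⟩ := hev
  by_cases hre : (fun x => EuclideanSpace.realPart (w x)) = 0
  · refine ⟨fun x => EuclideanSpace.realPart ((-Complex.I) • w x), fun him => hw0 ?_, linNSResolventRel_imagPart hw⟩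
    funext x
    ext i
    have h1 : (w x i).re = 0 := by
      simpa using congrArg (fun v : UnitAddTorus (Fin 3) → EuclideanSpace ℝ (Fin 3) => v x i) hre
    have h2 : (w x i).im = 0 := by
      simpa using congrArg (fun v : UnitAddTorus (Fin 3) → EuclideanSpace ℝ (Fin 3) => v x i) him
    simp [Complex.ext_iff, h1, h2]
  · exact ⟨fun x => EuclideanSpace.realPart (w x), hre, linNSResolventRel_realPart hw⟩

end Summit.AnomalousDissipation.AnomalousDissipation.Theorems.RobustLoudUpgrade.Poly.RealKernel
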